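import Literature.MathematicalPhysics.QuantumManyBody.PeriodicMaxFormBoundHardCoreStep
import Literature.MathematicalPhysics.QuantumManyBody.BoseGasHardLayerDecay
import Literature.Analysis.FunctionSpaces.TorusLineACLSpectral
import HarnessLib

/-!
# MaxFormBound for hard-core pair potentials

Topic `Literature/MathematicalPhysics/QuantumManyBody`, sequel of `PeriodicMaxFormBoundHardCoreStep.lean`, `BoseGasHardLayerDecay.lean` and
`Literature.Analysis.FunctionSpaces.TorusLineACLSpectral`. **The periodic Bose `C¹` core is a form core of the
maximal form also for hard cores**: for every repulsive finite-range radial pair potential `v : ℝ → [0, ∞]`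
(measurable, `v = 0` beyond `R₀`, hard cores `v = ⊤` and non-integrable singularities allowed), `L > 0`, and every
unit `η ∈ L²((ℝ/ℤ)^{3N})` Bose-symmetric in momentum space,

  `periodicGroundStateEnergy v N L ≤ ∑ₙ (∑ₚ (2πnₚ/L)²) |⟪eₙ, η⟫|² + ∫ (W_v ∘ fromUnitTorusN L) |η|²`

(`maxFormBound_of_isRepulsiveFiniteRange`, the hypothesis `hcore` of the truncation / Γ-convergence reductions of the
BEC programme). The `L¹_loc` case is B. Simon's theorem (J. Operator Theory 1 (1979) 37–47, Thm. 2.1;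
[ReedSimonIV1978] Thm. XIII.64), in the tree as `periodicGroundStateEnergy_le_maxForm`; the hard-core case reduces to it:
a bounded finite-energy `η` has the ACL representatives of `Torus.exists_lineACL_repr`, hence (`exists_setLIntegral_hardLayer_le`)
its mass in the hard layer of width `s` is `o(s²)`, which is what the cut-off step
`periodicGroundStateEnergy_mul_le_maxForm_of_layerDecay` consumes; unbounded `η` are clamped (`clampC`).

Tagged folklore; cite [ReedSimonIV1978] Thm. XIII.64 for the variational principle behind it.
-/

noncomputable section

open MeasureTheory Filter Set Complex UnitAddTorus Metric
open scoped ENNReal NNReal Topology InnerProductSpace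

namespace Literature.MathematicalPhysics.QuantumManyBody.BoseGas

-- The measure on `ℝ/ℤ` is the Haar PROBABILITY measure, as in `PeriodicFormDomain.lean`.
attribute [local instance] formDomain_measureSpace formDomain_isProbabilityMeasure formDomain_isProbabilityMeasure_pi

variable {N : ℕ} {L : ℝ} {v : ℝ → ℝ≥0∞}

/-- Local notation for the Hilbert space `L²((ℝ/ℤ)^{3N})`, as in `PeriodicFormDomain.lean`. -/
local notation "L2T " N':max => Lp ℂ 2 (volume : Measure (UnitAddTorus (Fin N' × Fin 3)))

open Literature.Analysis.FunctionSpaces Literature.Analysis.OperatorTheory HardLayerAux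

/-! ### Bounded finite-energy classes have hard-layer decay -/

/-- The directional spectral energy in one coordinate is controlled by the kinetic energy:
`∑ₙ n_q² |η̂(n)|² ≤ (L/2π)² ∑ₙ (∑ₚ (2πnₚ/L)²) |⟪eₙ, η⟫|²`. [folklore] -/
theorem tsum_sq_coord_le_kinetic (hL : 0 < L) (η : L2T N) (q : Fin N × Fin 3) :
    ∑' n : Fin N × Fin 3 → ℤ, ENNReal.ofReal ((n q : ℝ) ^ 2) *
        ‖mFourierCoeff (η : UnitAddTorus (Fin N × Fin 3) → ℂ) n‖ₑ ^ 2 ≤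
      ENNReal.ofReal ((L / (2 * Real.pi)) ^ 2) *
        ∑' n : Fin N × Fin 3 → ℤ, ENNReal.ofReal (∑ p, (2 * Real.pi * (n p : ℝ) / L) ^ 2) *
          (‖⟪(mFourierLp 2 n : L2T N), η⟫_ℂ‖₊ : ℝ≥0∞) ^ 2 := by
  rw [← ENNReal.tsum_mul_left]
  refine ENNReal.tsum_le_tsum fun n => ?_
  rw [HaarTorus.inner_mFourierLp_eq_mFourierCoeff, enorm_eq_nnnorm, ← mul_assoc, ← ENNReal.ofReal_mul (sq_nonneg _)]
  gcongr
  have hq : (n q : ℝ) ^ 2 = (L / (2 * Real.pi)) ^ 2 * (2 * Real.pi * (n q : ℝ) / L) ^ 2 := by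
    field_simp
  rw [hq]
  exact mul_le_mul_of_nonneg_left (Finset.single_le_sum (f := fun p => (2 * Real.pi * (n p : ℝ) / L) ^ 2)
    (fun _ _ => sq_nonneg _) (Finset.mem_univ q)) (sq_nonneg _)

/-- **Bounded finite-energy classes have hard-layer decay.** For `v` measurable with nonempty hard radii bounded by
`R₀`, `L > 0`, and `ζ ∈ L²((ℝ/ℤ)^{3N})` essentially bounded with finite kinetic and potential maximal-form energy,
`∫_{fromUnitTorusN L ⁻¹' hardLayer v L s} |ζ|² = o(s²)`. [folklore] -/
theorem hardLayer_decay_of_bound (hL : 0 < L) (hv : Measurable v) {R₀ : ℝ} (hSR : ∀ b ∈ hardRad v, b ≤ R₀)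
    (hS : (hardRad v).Nonempty) (ζ : L2T N) {k : ℝ}
    (hbound : ∀ᵐ t ∂(volume : Measure (UnitAddTorus (Fin N × Fin 3))), ‖(ζ : UnitAddTorus (Fin N × Fin 3) → ℂ) t‖ ≤ k)
    (hK : (∑' n : Fin N × Fin 3 → ℤ, ENNReal.ofReal (∑ p, (2 * Real.pi * (n p : ℝ) / L) ^ 2) *
        (‖⟪(mFourierLp 2 n : L2T N), ζ⟫_ℂ‖₊ : ℝ≥0∞) ^ 2) ≠ ⊤)
    (hV : (∫⁻ t, periodicInteraction v L (fromUnitTorusN L t) *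
        (‖(ζ : UnitAddTorus (Fin N × Fin 3) → ℂ) t‖₊ : ℝ≥0∞) ^ 2) ≠ ⊤)
    {ε' : ℝ} (hε' : 0 < ε') :
    ∃ s₀ : ℝ, 0 < s₀ ∧ ∀ s : ℝ, 0 < s → s ≤ s₀ →
      ∫⁻ t in fromUnitTorusN L ⁻¹' (hardLayer v L s : Set (Config N)),
        ((‖(ζ : UnitAddTorus (Fin N × Fin 3) → ℂ) t‖₊ : ℝ≥0∞)) ^ 2 ≤ ENNReal.ofReal (ε' * s ^ 2) := by
  classical
  set η : UnitAddTorus (Fin N × Fin 3) → ℂ := (ζ : UnitAddTorus (Fin N × Fin 3) → ℂ) with hη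
  have hηm : Measurable η := (Lp.stronglyMeasurable ζ).measurable
  have hηmem : MemLp η 2 volume := Lp.memLp ζ
  -- the ACL representatives, one for each coordinate
  have hKq : ∀ q : Fin N × Fin 3, ∑' n : Fin N × Fin 3 → ℤ, ENNReal.ofReal ((n q : ℝ) ^ 2) * ‖mFourierCoeff η n‖ₑ ^ 2 ≠ ⊤ :=
    fun q => ne_top_of_le_ne_top (ENNReal.mul_ne_top ENNReal.ofReal_ne_top hK) (tsum_sq_coord_le_kinetic hL ζ q)
  choose G H hGm hHm hGη hHmem _hHcoef hACL using fun q : Fin N × Fin 3 => Torus.exists_lineACL_repr q hηm hηmem (hKq q)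
  have hHfin : ∀ q, ∫⁻ t, ‖H q t‖ₑ ^ 2 ≠ ⊤ := fun q => by
    have h := lintegral_rpow_enorm_lt_top_of_eLpNorm_lt_top two_ne_zero ENNReal.ofNat_ne_top (hHmem q).eLpNorm_lt_top
    simp only [ENNReal.toReal_ofNat, ENNReal.rpow_two] at h
    exact h.ne
  -- the line potential energy is locally finite on almost every line
  have hWm : Measurable fun t : UnitAddTorus (Fin N × Fin 3) => periodicInteraction v L (fromUnitTorusN L t) :=
    (measurable_periodicInteraction_hc hv L).comp (measurable_fromUnitTorusN L)
  have hgood : ∀ q : Fin N × Fin 3, ∀ᵐ t ∂(volume : Measure (UnitAddTorus (Fin N × Fin 3))),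
      (∀ a b : ℝ, IntervalIntegrable (fun x : ℝ => H q (t + Pi.single q ((x : ℝ) : UnitAddCircle))) volume a b ∧
        G q (t + Pi.single q ((b : ℝ) : UnitAddCircle)) - G q (t + Pi.single q ((a : ℝ) : UnitAddCircle)) =
          ∫ x in a..b, H q (t + Pi.single q ((x : ℝ) : UnitAddCircle))) ∧
      (∀ a b : ℝ, ∫⁻ x in Ioo a b, periodicInteraction v L
        (fromUnitTorusN L (t + Pi.single q ((x : ℝ) : UnitAddCircle))) *
          ‖G q (t + Pi.single q ((x : ℝ) : UnitAddCircle))‖ₑ ^ 2 ≠ ⊤) := by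
    intro q
    have hΦm : Measurable fun t => periodicInteraction v L (fromUnitTorusN L t) * ‖G q t‖ₑ ^ 2 :=
      hWm.mul ((hGm q).enorm.pow_const 2)
    have hΦfin : ∫⁻ t, periodicInteraction v L (fromUnitTorusN L t) * ‖G q t‖ₑ ^ 2 ≠ ⊤ := by
      rw [lintegral_congr_ae ((hGη q).mono fun t ht =>
        show periodicInteraction v L (fromUnitTorusN L t) * ‖G q t‖ₑ ^ 2 =
          periodicInteraction v L (fromUnitTorusN L t) * ‖η t‖ₑ ^ 2 by rw [ht])]
      simpa only [enorm_eq_nnnorm] using hV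
    filter_upwards [hACL q, Torus.ae_lintegral_line_lt_top q hΦm hΦfin] with t ht hfin
    refine ⟨ht, fun a b => ?_⟩
    obtain ⟨M, hM⟩ := exists_nat_ge (max |a| |b|)
    refine (lt_of_le_of_lt (lintegral_mono_set fun x hx => ?_) (hfin M)).ne
    have ha : |a| ≤ M := (le_max_left _ _).trans hM
    have hb : |b| ≤ M := (le_max_right _ _).trans hM
    exact ⟨by linarith [hx.1, neg_abs_le a], by linarith [hx.2, le_abs_self b]⟩
  obtain ⟨s₀, hs₀, h⟩ := exists_setLIntegral_hardLayer_le hL hv hSR hS (η := η) hGη hHm hHfin hgood hbound hε'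
  exact ⟨s₀, hs₀, fun s hs hss₀ => by simpa only [hη, enorm_eq_nnnorm] using h s hs hss₀⟩

/-! ### MaxFormBound -/

/-- **MaxFormBound for finite-range potentials, bounded class.** [cite: ReedSimonIV1978, Thm. XIII.64] -/
theorem periodicGroundStateEnergy_mul_le_maxForm_of_bound_finiteRange (hL : 0 < L) (hv : Measurable v) {R₀ : ℝ}
    (hv0 : ∀ r, R₀ < r → v r = 0) (ζ : L2T N) {k : ℝ}
    (hbound : ∀ᵐ t ∂(volume : Measure (UnitAddTorus (Fin N × Fin 3))), ‖(ζ : UnitAddTorus (Fin N × Fin 3) → ℂ) t‖ ≤ k)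
    (hsymm : ∀ (σ : Equiv.Perm (Fin N)) (n : Fin N × Fin 3 → ℤ),
      ⟪(mFourierLp 2 (fun p : Fin N × Fin 3 => n (σ p.1, p.2)) : L2T N), ζ⟫_ℂ = ⟪(mFourierLp 2 n : L2T N), ζ⟫_ℂ) :
    periodicGroundStateEnergy v N L * ENNReal.ofReal (‖ζ‖ ^ 2) ≤
      (∑' n : Fin N × Fin 3 → ℤ, ENNReal.ofReal (∑ p, (2 * Real.pi * (n p : ℝ) / L) ^ 2) *
          (‖⟪(mFourierLp 2 n : L2T N), ζ⟫_ℂ‖₊ : ℝ≥0∞) ^ 2) +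
        ∫⁻ t, periodicInteraction v L (fromUnitTorusN L t) *
          (‖(ζ : UnitAddTorus (Fin N × Fin 3) → ℂ) t‖₊ : ℝ≥0∞) ^ 2 := by
  rcases (hardRad v).eq_empty_or_nonempty with hS | hS
  · -- no hard radii: the interaction is integrable on the cell
    exact periodicGroundStateEnergy_mul_le_maxForm hL hv
      (lintegral_cellN_periodicInteraction_ne_top_of_lintegral_ne_top hL hv
        (lintegral_norm_ne_top_of_hardRad_eq_empty hv0 hS) N) ζ hsymm
  by_cases hQ : (∑' n : Fin N × Fin 3 → ℤ, ENNReal.ofReal (∑ p, (2 * Real.pi * (n p : ℝ) / L) ^ 2) *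
      (‖⟪(mFourierLp 2 n : L2T N), ζ⟫_ℂ‖₊ : ℝ≥0∞) ^ 2) +
      ∫⁻ t, periodicInteraction v L (fromUnitTorusN L t) * (‖(ζ : UnitAddTorus (Fin N × Fin 3) → ℂ) t‖₊ : ℝ≥0∞) ^ 2 = ⊤
  · rw [hQ]; exact le_top
  rw [ENNReal.add_eq_top, not_or] at hQ
  exact periodicGroundStateEnergy_mul_le_maxForm_of_layerDecay hL hv hv0 ζ hsymm fun ε' hε' =>
    hardLayer_decay_of_bound hL hv (fun b hb => le_of_mem_hardRad hv0 hb) hS ζ hbound hQ.1 hQ.2 hε'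

/-- **MaxFormBound for finite-range potentials, general Bose-symmetric class**:
`E₀(v) · ‖η‖² ≤ ∑ₙ (∑ₚ (2πnₚ/L)²) |⟪eₙ, η⟫|² + ∫ (W_v ∘ fromUnitTorusN L) |η|²` (clamp truncations and the bounded
case). [cite: ReedSimonIV1978, Thm. XIII.64] -/
theorem periodicGroundStateEnergy_mul_le_maxForm_finiteRange (hL : 0 < L) (hv : Measurable v) {R₀ : ℝ}
    (hv0 : ∀ r, R₀ < r → v r = 0) (η : L2T N)
    (hsymm : ∀ (σ : Equiv.Perm (Fin N)) (n : Fin N × Fin 3 → ℤ),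
      ⟪(mFourierLp 2 (fun p : Fin N × Fin 3 => n (σ p.1, p.2)) : L2T N), η⟫_ℂ = ⟪(mFourierLp 2 n : L2T N), η⟫_ℂ) :
    periodicGroundStateEnergy v N L * ENNReal.ofReal (‖η‖ ^ 2) ≤
      (∑' n : Fin N × Fin 3 → ℤ, ENNReal.ofReal (∑ p, (2 * Real.pi * (n p : ℝ) / L) ^ 2) *
          (‖⟪(mFourierLp 2 n : L2T N), η⟫_ℂ‖₊ : ℝ≥0∞) ^ 2) +
        ∫⁻ t, periodicInteraction v L (fromUnitTorusN L t) *
          (‖(η : UnitAddTorus (Fin N × Fin 3) → ℂ) t‖₊ : ℝ≥0∞) ^ 2 := by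
  set f : ℕ → L2T N := fun k => (lipschitzWith_clampC (k : ℝ)).compLp (clampC_zero (Nat.cast_nonneg k)) η with hf
  -- the bounded case for each truncation
  have hk : ∀ k : ℕ, periodicGroundStateEnergy v N L * ENNReal.ofReal (‖f k‖ ^ 2) ≤
      (∑' n : Fin N × Fin 3 → ℤ, ENNReal.ofReal (∑ p, (2 * Real.pi * (n p : ℝ) / L) ^ 2) *
          (‖⟪(mFourierLp 2 n : L2T N), η⟫_ℂ‖₊ : ℝ≥0∞) ^ 2) +
        ∫⁻ t, periodicInteraction v L (fromUnitTorusN L t) *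
          (‖(η : UnitAddTorus (Fin N × Fin 3) → ℂ) t‖₊ : ℝ≥0∞) ^ 2 := fun k =>
    (periodicGroundStateEnergy_mul_le_maxForm_of_bound_finiteRange hL hv hv0 (f k) (ae_norm_clampLp_le η k)
      (inner_symm_clampLp η k hsymm)).trans
      (add_le_add (tsum_kinetic_clampLp_le η k) (lintegral_pot_clampLp_le η k _))
  -- `‖f k‖² → ‖η‖²` as `ℝ≥0∞`-integrals
  have hnorm : ∀ x : L2T N, ENNReal.ofReal (‖x‖ ^ 2) = ∫⁻ t, ((‖(x : UnitAddTorus (Fin N × Fin 3) → ℂ) t‖₊ : ℝ≥0∞)) ^ 2 :=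
    fun x => by rw [(norm_Lp_two_sq_eq_toReal x).1, ENNReal.ofReal_toReal (norm_Lp_two_sq_eq_toReal x).2]
  simp only [hnorm] at hk ⊢
  by_cases h0 : ∫⁻ t, ((‖(η : UnitAddTorus (Fin N × Fin 3) → ℂ) t‖₊ : ℝ≥0∞)) ^ 2 = 0
  · rw [h0, mul_zero]
    exact zero_le
  have hlim := ENNReal.Tendsto.const_mul (tendsto_lintegral_clampLp_sq η) (Or.inl h0)
    (a := periodicGroundStateEnergy v N L)
  exact le_of_tendsto' hlim hk

/-- **MaxFormBound for repulsive finite-range pair potentials (hard cores allowed).** For `L > 0` and every UNIT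
`η ∈ L²((ℝ/ℤ)^{3N})` Bose-symmetric in momentum space,
`periodicGroundStateEnergy v N L ≤ ∑ₙ (∑ₚ (2πnₚ/L)²) |⟪eₙ, η⟫|² + ∫ (W_v ∘ fromUnitTorusN L) |η|²`.
[cite: ReedSimonIV1978, Thm. XIII.64] -/
theorem periodicGroundStateEnergy_le_maxForm_finiteRange (hL : 0 < L) (hvfr : IsRepulsiveFiniteRange v) (η : L2T N)
    (hη : ‖η‖ = 1)
    (hsymm : ∀ (σ : Equiv.Perm (Fin N)) (n : Fin N × Fin 3 → ℤ),
      ⟪(mFourierLp 2 (fun p : Fin N × Fin 3 => n (σ p.1, p.2)) : L2T N), η⟫_ℂ = ⟪(mFourierLp 2 n : L2T N), η⟫_ℂ) :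
    periodicGroundStateEnergy v N L ≤
      (∑' n : Fin N × Fin 3 → ℤ, ENNReal.ofReal (∑ p, (2 * Real.pi * (n p : ℝ) / L) ^ 2) *
          (‖⟪(mFourierLp 2 n : L2T N), η⟫_ℂ‖₊ : ℝ≥0∞) ^ 2) +
        ∫⁻ t, periodicInteraction v L (fromUnitTorusN L t) *
          (‖(η : UnitAddTorus (Fin N × Fin 3) → ℂ) t‖₊ : ℝ≥0∞) ^ 2 := by
  obtain ⟨R₀, hv0⟩ := hvfr.2
  have h := periodicGroundStateEnergy_mul_le_maxForm_finiteRange hL hvfr.1 hv0 η hsymm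
  rwa [hη, one_pow, ENNReal.ofReal_one, mul_one] at h

/-- **MaxFormBound** in the shape consumed by the BEC reductions (`hcore` of the truncation / Γ-convergence
arguments): for every repulsive finite-range `v`, every `N`, `L > 0` and unit Bose-symmetric `η`, the periodic
ground-state energy is bounded by the maximal form of `η`. [cite: ReedSimonIV1978, Thm. XIII.64] -/
theorem maxFormBound_of_isRepulsiveFiniteRange :
    ∀ v : ℝ → ℝ≥0∞, IsRepulsiveFiniteRange v → ∀ (N : ℕ) (L : ℝ), 0 < L →
      ∀ η : Lp ℂ 2 (volume : Measure (UnitAddTorus (Fin N × Fin 3))), ‖η‖ = 1 →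
        (∀ (σ : Equiv.Perm (Fin N)) (n : Fin N × Fin 3 → ℤ),
          ⟪(mFourierLp 2 (fun p : Fin N × Fin 3 => n (σ p.1, p.2)) : Lp ℂ 2 volume), η⟫_ℂ =
            ⟪(mFourierLp 2 n : Lp ℂ 2 volume), η⟫_ℂ) →
        periodicGroundStateEnergy v N L ≤
          ∑' n : Fin N × Fin 3 → ℤ, ENNReal.ofReal (∑ p, (2 * Real.pi * (n p : ℝ) / L) ^ 2) *
              (‖⟪(mFourierLp 2 n : Lp ℂ 2 volume), η⟫_ℂ‖₊ : ℝ≥0∞) ^ 2 +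
            ∫⁻ t, periodicInteraction v L (fromUnitTorusN L t) *
              (‖(η : UnitAddTorus (Fin N × Fin 3) → ℂ) t‖₊ : ℝ≥0∞) ^ 2 :=
  fun _ hvfr _ _ hL η hη hsymm => periodicGroundStateEnergy_le_maxForm_finiteRange hL hvfr η hη hsymm

end Literature.MathematicalPhysics.QuantumManyBody.BoseGas

end
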